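import Summits.ValiantsHypothesis.ValiantsHypothesis.Theorems.BarrierLeverChowBenchmarkPairsHyperplane

/-!
# Route BarrierLever — item 22038 `ChowBenchmarkPairs`, line `moore-peel`: the PARALLEL-EDGE and COLLINEARITY no-go's for GENERAL point tables

Helper file (`--supports stmt-ValiantsHypothesis-22038`; cell valiant-natproofs, rung V4, 𝒟-side benchmark of record; seat val-np-p4
gen 20; companion of `…ChowBenchmarkPairsHyperplane` (p633941) and of the 0/1 no-go `…ChowBenchmarkPairsZeroOneNoGo`
(p629307, `det_zoTable_eq_zero_of_parallel_edges`)).  Closes NO item; definition-free.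

THE RULE (design rule R1 for arbitrary tables).  Let `P : Fin h → Fin h → ℂ` be any point table.  If two DIFFERENT pairs of points differ
by vectors parallel to the SAME coordinate axis `e_u` — `P x' = P x + λ e_u` and `P b' = P b + μ e_u` (any `λ, μ`, four points
`x ≠ x'`, `b ≠ b'`, `{x, x'} ∩ {b, b'} = ∅`) — then the four pair rows of the segment-moment matrix satisfy
`row{x,b} + row{x',b'} = row{x,b'} + row{x',b}`, so the matrix is singular for every height and every enumeration of the rows
(`det_segMatrix_eq_zero_of_parallel_coordinate_edges`, `det_eq_zero_of_parallel_coordinate_edges`).  The 0/1 rule of p629307 is the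
case `P = zoTable σ`, `λ = μ = 1`.

MECHANISM.  A pair entry `pairSum P x b T = Σ_{d ⊆ T} |d|!|T∖d|!·(∏_{c∈d} P x c)(∏_{c∈T∖d} P b c)` is AFFINE in the `u`-th coordinate of
each of the two points separately and has no term using the coordinate `u` of both (the monomials are squarefree: `u` lies in `d` or in
`T ∖ d`, not in both); the alternating sum over the rectangle `{P x, P x'} × {P b, P b'}` of such a function vanishes term by term
(`pairSum_parallel`).  In the zeon algebra: `(R_{x'} − R_x)(R_{b'} − R_b) = λμ·y_u²·R_xR_{x'}R_bR_{b'} = 0`.  Two parallel differences in a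
GENERIC (non-coordinate) direction do NOT force singularity (census kit j308240, column 'paredgeGen': full rank for every h ≤ 34).

THE SECOND RULE (design rule R0: no three of `0, P_1, …, P_h` collinear — the Orlik–Terao circuit relation).  If three points are
affinely dependent, `P c = α P a + β P b` with `α + β = 1`, then `α·row{b,c} + β·row{a,c} = row{a,b}`
(`det_segMatrix_eq_zero_of_collinear`); if a point is a multiple of another, `P b = λ P a` (collinear with the origin `P_0 = 0`; `λ = 0, 1`
allowed), then `row{a} = (1−λ)·row{a,b} + λ·row{b}` (`det_segMatrix_eq_zero_of_collinear_origin`).  MECHANISM: in the polynomial ring, with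
the truncated inverses `t_a` of `…ChowCubeThetaHat` (`t_a·A_a ≡ 1` on squarefree monomials, `coeff_mul_tinv_mul_affineY`, `A_a = 1 + Σ_c P_{ac} y_c`)
a linear relation `αA_a + βA_b = A_c` among the affine forms multiplies by `t_at_bt_c` to the relation `α t_bt_c + β t_at_c ≡ t_at_b` among pair
products — the size-3 circuits of the affine arrangement `{A_a}` are exactly the collinear triples (`pairSum_collinear`, `pairSum_collinear_origin`).
Census (kit j308240/j308241, h ≤ 34): both configurations have corank exactly 1.

WHAT THIS IS NOT: a constraint on witnesses of the ∀h stubs only; no stub of the line is closed; nothing on items 20172 / 19717, crux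
stmt-ValiantsHypothesis-14610, or `VP` versus `VNP`.
-/

set_option linter.dupNamespace false

namespace Summit.ValiantsHypothesis.ValiantsHypothesis.Theorems.BarrierLever.ChowBenchmarkHyperplane

open Finset MvPolynomial
open Summit.ValiantsHypothesis.ValiantsHypothesis.Theorems.BarrierLever.MoorePeel
  (benchCols windowStart_succ_le_two_pow)
open Summit.ValiantsHypothesis.ValiantsHypothesis.Theorems.BarrierLever.ChowBenchmarkDual
  (eq_windowStart_of_enumeration segSum_pair thetaHat_row_eq_sign_mul_segSum)
open Summit.ValiantsHypothesis.ValiantsHypothesis.Theorems.BarrierLever.ChowCube (coeff_mul_tinv_mul_affineY coeff_tinv)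

variable {h : ℕ}

noncomputable section

/-- **The rectangle identity.**  If `P x' = P x + λ e_u` and `P b' = P b + μ e_u` then at every column `T`
`pairSum P x b T + pairSum P x' b' T − pairSum P x b' T − pairSum P x' b T = 0`. -/
theorem pairSum_parallel (P : Fin h → Fin h → ℂ) {x x' b b' u : Fin h} {lam mu : ℂ}
    (hx : ∀ c, P x' c = P x c + if c = u then lam else 0)
    (hb : ∀ c, P b' c = P b c + if c = u then mu else 0) (T : Finset (Fin h)) :
    pairSum P x b T + pairSum P x' b' T - pairSum P x b' T - pairSum P x' b T = 0 := by
  classical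
  unfold pairSum
  rw [← Finset.sum_add_distrib, ← Finset.sum_sub_distrib, ← Finset.sum_sub_distrib]
  refine Finset.sum_eq_zero fun d _ => ?_
  have key : ((∏ c ∈ d, P x' c) - ∏ c ∈ d, P x c) * ((∏ c ∈ T \ d, P b' c) - ∏ c ∈ T \ d, P b c) = 0 := by
    by_cases hu : u ∈ d
    · have hue : u ∉ T \ d := fun h' => (Finset.mem_sdiff.mp h').2 hu
      have e : ∏ c ∈ T \ d, P b' c = ∏ c ∈ T \ d, P b c :=
        Finset.prod_congr rfl fun c hc => by
          have hcu : c ≠ u := fun e => hue (e ▸ hc)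
          rw [hb c, if_neg hcu, add_zero]
      rw [e, sub_self, mul_zero]
    · have e : ∏ c ∈ d, P x' c = ∏ c ∈ d, P x c :=
        Finset.prod_congr rfl fun c hc => by
          have hcu : c ≠ u := fun e => hu (e ▸ hc)
          rw [hx c, if_neg hcu, add_zero]
      rw [e, sub_self, zero_mul]
  linear_combination ((d.card.factorial : ℂ) * ((T \ d).card.factorial : ℂ)) * key

/-- Two pairs `{p, q} = {p', q'}` of `Fin h` coincide iff they coincide up to order. -/
theorem pair_eq_pair_iff (p q p' q' : Fin h) (e : ({p, q} : Finset (Fin h)) = {p', q'}) :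
    (p = p' ∧ q = q') ∨ (p = q' ∧ q = p') := by
  classical
  have hp : p ∈ ({p', q'} : Finset (Fin h)) := by rw [← e]; simp
  have hq : q ∈ ({p', q'} : Finset (Fin h)) := by rw [← e]; simp
  have hp' : p' ∈ ({p, q} : Finset (Fin h)) := by rw [e]; simp
  have hq' : q' ∈ ({p, q} : Finset (Fin h)) := by rw [e]; simp
  simp only [Finset.mem_insert, Finset.mem_singleton] at hp hq hp' hq'
  rcases hp with rfl | rfl
  · rcases hq with rfl | rfl
    · rcases hq' with h1 | h1 <;> exact Or.inl ⟨rfl, h1.symm⟩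
    · exact Or.inl ⟨rfl, rfl⟩
  · rcases hq with rfl | rfl
    · exact Or.inr ⟨rfl, rfl⟩
    · rcases hp' with h1 | h1 <;> exact Or.inr ⟨rfl, h1.symm⟩

/-- **Parallel coordinate edges kill every table (matrix form).**  If `P x' − P x = λ e_u` and `P b' − P b = μ e_u` for four points with
`x ≠ x'`, `b ≠ b'` and `{x,x'} ∩ {b,b'} = ∅`, then for every enumeration `uu` of rows hitting all pairs the segment-moment matrix has
determinant `0` (the rows `{x,b}, {x',b'}, {x,b'}, {x',b}` are dependent, `+ + − −`). -/
theorem det_segMatrix_eq_zero_of_parallel_coordinate_edges {r : ℕ} (P : Fin h → Fin h → ℂ) (x x' b b' u : Fin h)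
    (lam mu : ℂ) (hx : ∀ c, P x' c = P x c + if c = u then lam else 0)
    (hb : ∀ c, P b' c = P b c + if c = u then mu else 0)
    (hxx' : x ≠ x') (hbb' : b ≠ b') (hxb : x ≠ b) (hxb' : x ≠ b') (hx'b : x' ≠ b) (hx'b' : x' ≠ b')
    (uu : Fin r → Finset (Fin h)) (hsurj : ∀ S : Finset (Fin h), S.card ≤ 2 → ∃ i, uu i = S) :
    (segMatrix r P uu).det = 0 := by
  classical
  set M := segMatrix r P uu with hM
  have card2 : ∀ p q : Fin h, p ≠ q → ({p, q} : Finset (Fin h)).card ≤ 2 := fun p q hpq => by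
    rw [Finset.card_pair hpq]
  obtain ⟨i₁, hi₁⟩ := hsurj {x, b} (card2 x b hxb)
  obtain ⟨i₂, hi₂⟩ := hsurj {x', b'} (card2 x' b' hx'b')
  obtain ⟨i₃, hi₃⟩ := hsurj {x, b'} (card2 x b' hxb')
  obtain ⟨i₄, hi₄⟩ := hsurj {x', b} (card2 x' b hx'b)
  have n12 : i₁ ≠ i₂ := by
    intro e; rcases pair_eq_pair_iff x b x' b' (by rw [← hi₁, ← hi₂, e]) with ⟨h1, _⟩ | ⟨h1, _⟩
    · exact hxx' h1
    · exact hxb' h1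
  have n13 : i₁ ≠ i₃ := by
    intro e; rcases pair_eq_pair_iff x b x b' (by rw [← hi₁, ← hi₃, e]) with ⟨_, h2⟩ | ⟨h1, _⟩
    · exact hbb' h2
    · exact hxb' h1
  have n14 : i₁ ≠ i₄ := by
    intro e; rcases pair_eq_pair_iff x b x' b (by rw [← hi₁, ← hi₄, e]) with ⟨h1, _⟩ | ⟨h1, _⟩
    · exact hxx' h1
    · exact hxb h1
  have n23 : i₂ ≠ i₃ := by
    intro e; rcases pair_eq_pair_iff x' b' x b' (by rw [← hi₂, ← hi₃, e]) with ⟨h1, _⟩ | ⟨h1, _⟩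
    · exact hxx' h1.symm
    · exact hx'b' h1
  have n24 : i₂ ≠ i₄ := by
    intro e; rcases pair_eq_pair_iff x' b' x' b (by rw [← hi₂, ← hi₄, e]) with ⟨_, h2⟩ | ⟨h1, _⟩
    · exact hbb' h2.symm
    · exact hx'b h1
  have n34 : i₃ ≠ i₄ := by
    intro e; rcases pair_eq_pair_iff x b' x' b (by rw [← hi₃, ← hi₄, e]) with ⟨h1, _⟩ | ⟨h1, _⟩
    · exact hxx' h1
    · exact hxb h1
  let v : Fin r → ℂ := Pi.single i₁ 1 + Pi.single i₂ 1 - Pi.single i₃ 1 - Pi.single i₄ 1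
  have hv0 : v ≠ 0 := by
    intro hv
    have := congr_fun hv i₁
    simp only [v, Pi.add_apply, Pi.sub_apply, Pi.single_eq_same, Pi.single_eq_of_ne n12, Pi.single_eq_of_ne n13,
      Pi.single_eq_of_ne n14, Pi.zero_apply] at this
    norm_num at this
  have hvM : Matrix.vecMul v M = 0 := by
    funext j
    simp only [v, Matrix.add_vecMul, Matrix.sub_vecMul, Matrix.single_one_vecMul, Pi.add_apply, Pi.sub_apply,
      Matrix.row_apply, Pi.zero_apply]
    rw [hM, segMatrix_row_pair P uu hxb hi₁ j, segMatrix_row_pair P uu hx'b' hi₂ j, segMatrix_row_pair P uu hxb' hi₃ j,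
      segMatrix_row_pair P uu hx'b hi₄ j]
    exact pairSum_parallel P hx hb (benchCols h r j)
  exact (Matrix.exists_vecMul_eq_zero_iff).mp ⟨v, hv0, hvM⟩

/-- **Parallel coordinate edges kill every table — the line's form** (the matrix of `SegmentMeanValueAt h`, verbatim): no table with two
point-differences parallel to one coordinate axis is a witness of `stub_segmentMeanValue` / `stub_s10` / `stub_zeroOneDesign`. -/
theorem det_eq_zero_of_parallel_coordinate_edges {r : ℕ} (P : Fin h → Fin h → ℂ) (x x' b b' u : Fin h) (lam mu : ℂ)
    (hx : ∀ c, P x' c = P x c + if c = u then lam else 0) (hb : ∀ c, P b' c = P b c + if c = u then mu else 0)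
    (hxx' : x ≠ x') (hbb' : b ≠ b') (hxb : x ≠ b) (hxb' : x ≠ b') (hx'b : x' ≠ b) (hx'b' : x' ≠ b')
    (uu : Fin r → Finset (Fin h)) (hsurj : ∀ S : Finset (Fin h), S.card ≤ 2 → ∃ i, uu i = S) :
    (Matrix.of fun i j : Fin r =>
      ∑ g : (↥(benchCols h r j) → ↥(uu i)), (∏ c : ↥(benchCols h r j), P (g c) c) *
        ∏ a : ↥(uu i), ((Finset.univ.filter fun c : ↥(benchCols h r j) => g c = a).card.factorial : ℂ)).det = 0 :=
  det_segMatrix_eq_zero_of_parallel_coordinate_edges P x x' b b' u lam mu hx hb hxx' hbb' hxb hxb' hx'b hx'b' uu hsurj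

/-! ## 2. Collinear triples: the truncated-inverse calculus -/

/-- The squarefree exponent `E ∅ T = Σ_{c∈T} e_{y_c}` (conventions of `…ChowCubeThetaHat`). -/
def expo0 (T : Finset (Fin h)) : Fin (h + h) →₀ ℕ :=
  ∑ a ∈ (∅ : Finset (Fin h)), Finsupp.single (Fin.castAdd h a) 1 + ∑ c ∈ T, Finsupp.single (Fin.natAdd h c) 1

/-- The truncated inverse `t_a = Σ_S (-1)^{|S|}|S|!·q_a^S·y^S` of the affine form `A_a` (verbatim from `…ChowCubeThetaHat`). -/
def tinvPoly (q : Fin h → Fin h → ℂ) (a : Fin h) : MvPolynomial (Fin (h + h)) ℂ :=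
  ∑ S ∈ (Finset.univ : Finset (Fin h)).powerset,
    monomial (∑ a' ∈ (∅ : Finset (Fin h)), Finsupp.single (Fin.castAdd h a') 1 +
      ∑ c ∈ S, Finsupp.single (Fin.natAdd h c) 1)
      ((-1 : ℂ) ^ S.card * (S.card.factorial : ℂ) * ∏ c ∈ S, q a c)

/-- The affine `y`-form `A_a = 1 + Σ_c q_{ac} y_c` of the point `a`. -/
def affY (q : Fin h → Fin h → ℂ) (a : Fin h) : MvPolynomial (Fin (h + h)) ℂ :=
  1 + ∑ c, C (q a c) * X (Fin.natAdd h c)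

/-- `t_a · A_a ≡ 1` on squarefree monomials: multiplying by `t_a A_a` does not change squarefree coefficients
(`ChowCube.coeff_mul_tinv_mul_affineY`). -/
theorem coeff_mul_tinv_affY (F : MvPolynomial (Fin (h + h)) ℂ) (q : Fin h → Fin h → ℂ) (a : Fin h)
    (T : Finset (Fin h)) : coeff (expo0 T) (F * (tinvPoly q a * affY q a)) = coeff (expo0 T) F := by
  unfold expo0 tinvPoly affY
  exact coeff_mul_tinv_mul_affineY F (q a) ∅ T

/-- The squarefree coefficients of a product of two truncated inverses are the signed pair segment sums:
`coeff (E ∅ T) (t_a t_b) = (-1)^{|T|}·pairSum q a b T`. -/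
theorem coeff_tinv_mul_tinv (q : Fin h → Fin h → ℂ) {a b : Fin h} (hab : a ≠ b) (T : Finset (Fin h)) :
    coeff (expo0 T) (tinvPoly q a * tinvPoly q b) = (-1 : ℂ) ^ T.card * pairSum q a b T := by
  classical
  have hcard : ({a, b} : Finset (Fin h)).card ≤ 2 := by rw [Finset.card_pair hab]
  have e := thetaHat_row_eq_sign_mul_segSum q {a, b} hcard T
  rw [Finset.prod_pair hab, segSum_pair q a b hab T] at e
  unfold expo0 tinvPoly pairSum
  exact e

/-- The squarefree coefficients of one truncated inverse: `coeff (E ∅ T) t_a = (-1)^{|T|}·|T|!·∏_{c∈T} q a c`. -/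
theorem coeff_tinvPoly (q : Fin h → Fin h → ℂ) (a : Fin h) (T : Finset (Fin h)) :
    coeff (expo0 T) (tinvPoly q a) = (-1 : ℂ) ^ T.card * ((T.card.factorial : ℂ) * ∏ c ∈ T, q a c) := by
  unfold expo0 tinvPoly
  rw [coeff_tinv, mul_assoc]

/-- An affine combination of points is the same affine combination of affine forms:
`q c = α q a + β q b`, `α + β = 1` ⟹ `A_c = α A_a + β A_b`. -/
theorem affY_affine_comb (q : Fin h → Fin h → ℂ) {a b c : Fin h} {α β : ℂ} (hαβ : α + β = 1)
    (hq : ∀ x, q c x = α * q a x + β * q b x) : affY q c = C α * affY q a + C β * affY q b := by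
  unfold affY
  have e1 : (∑ x : Fin h, C (q c x) * X (Fin.natAdd h x) : MvPolynomial (Fin (h + h)) ℂ) =
      C α * ∑ x : Fin h, C (q a x) * X (Fin.natAdd h x) + C β * ∑ x : Fin h, C (q b x) * X (Fin.natAdd h x) := by
    rw [Finset.mul_sum, Finset.mul_sum, ← Finset.sum_add_distrib]
    refine Finset.sum_congr rfl fun x _ => ?_
    rw [hq x, C_add, C_mul, C_mul]
    ring
  have e2 : (1 : MvPolynomial (Fin (h + h)) ℂ) = C α + C β := by
    rw [← C_add, hαβ, C_1]
  rw [e1]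
  nth_rewrite 1 [e2]
  ring

/-- **The collinearity identity.**  If `q c = α q a + β q b` coordinatewise with `α + β = 1` (three affinely dependent points),
then at every column `T`:  `α·pairSum q b c T + β·pairSum q a c T − pairSum q a b T = 0`. -/
theorem pairSum_collinear (q : Fin h → Fin h → ℂ) {a b c : Fin h} (hab : a ≠ b) (hac : a ≠ c) (hbc : b ≠ c)
    {α β : ℂ} (hαβ : α + β = 1) (hq : ∀ x, q c x = α * q a x + β * q b x) (T : Finset (Fin h)) :
    α * pairSum q b c T + β * pairSum q a c T - pairSum q a b T = 0 := by
  classical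
  have key : α * coeff (expo0 T) (tinvPoly q b * tinvPoly q c) + β * coeff (expo0 T) (tinvPoly q a * tinvPoly q c)
      - coeff (expo0 T) (tinvPoly q a * tinvPoly q b) = 0 := by
    rw [← coeff_mul_tinv_affY (tinvPoly q b * tinvPoly q c) q a T,
      ← coeff_mul_tinv_affY (tinvPoly q a * tinvPoly q c) q b T,
      ← coeff_mul_tinv_affY (tinvPoly q a * tinvPoly q b) q c T,
      ← smul_eq_mul α, ← smul_eq_mul β, ← coeff_smul, ← coeff_smul, ← coeff_add, ← coeff_sub,
      affY_affine_comb q hαβ hq]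
    have : (α • (tinvPoly q b * tinvPoly q c * (tinvPoly q a * affY q a)) +
        β • (tinvPoly q a * tinvPoly q c * (tinvPoly q b * affY q b)) -
        tinvPoly q a * tinvPoly q b * (tinvPoly q c * (C α * affY q a + C β * affY q b)) :
          MvPolynomial (Fin (h + h)) ℂ) = 0 := by
      rw [smul_eq_C_mul, smul_eq_C_mul]
      ring
    rw [this, coeff_zero]
  rw [coeff_tinv_mul_tinv q hbc, coeff_tinv_mul_tinv q hac, coeff_tinv_mul_tinv q hab] at key
  have hu : ((-1 : ℂ) ^ T.card) ≠ 0 := pow_ne_zero _ (by norm_num)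
  have : (-1 : ℂ) ^ T.card * (α * pairSum q b c T + β * pairSum q a c T - pairSum q a b T) = 0 := by
    rw [← key]; ring
  exact (mul_eq_zero.mp this).resolve_left hu

/-- **The collinearity identity through the origin.**  If `q b = λ·q a` coordinatewise, then at every column `T`:
`|T|!·q_a^T = (1 − λ)·pairSum q a b T + λ·|T|!·q_b^T`. -/
theorem pairSum_collinear_origin (q : Fin h → Fin h → ℂ) {a b : Fin h} (hab : a ≠ b) {lam : ℂ}
    (hq : ∀ x, q b x = lam * q a x) (T : Finset (Fin h)) :
    ((T.card.factorial : ℂ) * ∏ c ∈ T, q a c) -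
      ((1 - lam) * pairSum q a b T + lam * ((T.card.factorial : ℂ) * ∏ c ∈ T, q b c)) = 0 := by
  classical
  have hA : affY q b = C (1 - lam) + C lam * affY q a := by
    unfold affY
    rw [mul_add, mul_one, Finset.mul_sum, ← add_assoc, ← C_add, sub_add_cancel, C_1]
    congr 1
    refine Finset.sum_congr rfl fun x _ => ?_
    rw [hq x, C_mul]
    ring
  have key : coeff (expo0 T) (tinvPoly q a) - ((1 - lam) * coeff (expo0 T) (tinvPoly q a * tinvPoly q b)
      + lam * coeff (expo0 T) (tinvPoly q b)) = 0 := by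
    rw [← coeff_mul_tinv_affY (tinvPoly q a) q b T, ← coeff_mul_tinv_affY (tinvPoly q b) q a T,
      ← smul_eq_mul (1 - lam), ← smul_eq_mul lam, ← coeff_smul, ← coeff_smul, ← coeff_add, ← coeff_sub, hA]
    have : (tinvPoly q a * (tinvPoly q b * (C (1 - lam) + C lam * affY q a)) -
        ((1 - lam) • (tinvPoly q a * tinvPoly q b) + lam • (tinvPoly q b * (tinvPoly q a * affY q a))) :
          MvPolynomial (Fin (h + h)) ℂ) = 0 := by
      rw [smul_eq_C_mul, smul_eq_C_mul]
      ring
    rw [this, coeff_zero]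
  rw [coeff_tinv_mul_tinv q hab, coeff_tinvPoly, coeff_tinvPoly] at key
  have hu : ((-1 : ℂ) ^ T.card) ≠ 0 := pow_ne_zero _ (by norm_num)
  have : (-1 : ℂ) ^ T.card * (((T.card.factorial : ℂ) * ∏ c ∈ T, q a c) -
      ((1 - lam) * pairSum q a b T + lam * ((T.card.factorial : ℂ) * ∏ c ∈ T, q b c))) = 0 := by
    rw [← key]; ring
  exact (mul_eq_zero.mp this).resolve_left hu

/-! ## 3. Collinear triples: the no-go's -/

/-- **Three collinear points kill every table (matrix form).**  If `P c = α P a + β P b` with `α + β = 1` for three distinct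
points, then for every enumeration `uu` of rows hitting all pairs the segment-moment matrix has determinant `0`
(`α·row{b,c} + β·row{a,c} − row{a,b} = 0`). -/
theorem det_segMatrix_eq_zero_of_collinear {r : ℕ} (P : Fin h → Fin h → ℂ) (a b c : Fin h) (α β : ℂ)
    (hab : a ≠ b) (hac : a ≠ c) (hbc : b ≠ c) (hαβ : α + β = 1) (hP : ∀ x, P c x = α * P a x + β * P b x)
    (uu : Fin r → Finset (Fin h)) (hsurj : ∀ S : Finset (Fin h), S.card ≤ 2 → ∃ i, uu i = S) :
    (segMatrix r P uu).det = 0 := by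
  classical
  set M := segMatrix r P uu with hM
  have card2 : ∀ p q : Fin h, p ≠ q → ({p, q} : Finset (Fin h)).card ≤ 2 := fun p q hpq => by
    rw [Finset.card_pair hpq]
  obtain ⟨i₁, hi₁⟩ := hsurj {b, c} (card2 b c hbc)
  obtain ⟨i₂, hi₂⟩ := hsurj {a, c} (card2 a c hac)
  obtain ⟨i₃, hi₃⟩ := hsurj {a, b} (card2 a b hab)
  have n12 : i₁ ≠ i₂ := by
    intro e; rcases pair_eq_pair_iff b c a c (by rw [← hi₁, ← hi₂, e]) with ⟨h1, _⟩ | ⟨_, h2⟩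
    · exact hab h1.symm
    · exact hac h2.symm
  have n13 : i₁ ≠ i₃ := by
    intro e; rcases pair_eq_pair_iff b c a b (by rw [← hi₁, ← hi₃, e]) with ⟨h1, _⟩ | ⟨_, h2⟩
    · exact hab h1.symm
    · exact hac h2.symm
  have n23 : i₂ ≠ i₃ := by
    intro e; rcases pair_eq_pair_iff a c a b (by rw [← hi₂, ← hi₃, e]) with ⟨_, h2⟩ | ⟨h1, _⟩
    · exact hbc h2.symm
    · exact hab h1
  let v : Fin r → ℂ := α • Pi.single i₁ 1 + β • Pi.single i₂ 1 - Pi.single i₃ 1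
  have hv0 : v ≠ 0 := by
    intro hv
    have := congr_fun hv i₃
    simp only [v, Pi.add_apply, Pi.sub_apply, Pi.smul_apply, Pi.single_eq_same, Pi.single_eq_of_ne n13.symm,
      Pi.single_eq_of_ne n23.symm, Pi.zero_apply, smul_eq_mul, mul_zero] at this
    norm_num at this
  have hvM : Matrix.vecMul v M = 0 := by
    funext j
    simp only [v, Matrix.add_vecMul, Matrix.sub_vecMul, Matrix.smul_vecMul, Matrix.single_one_vecMul, Pi.add_apply,
      Pi.sub_apply, Pi.smul_apply, Matrix.row_apply, Pi.zero_apply, smul_eq_mul]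
    rw [hM, segMatrix_row_pair P uu hbc hi₁ j, segMatrix_row_pair P uu hac hi₂ j, segMatrix_row_pair P uu hab hi₃ j]
    exact pairSum_collinear P hab hac hbc hαβ hP (benchCols h r j)
  exact (Matrix.exists_vecMul_eq_zero_iff).mp ⟨v, hv0, hvM⟩

/-- **A point proportional to another (collinear with the origin) kills every table (matrix form).**  If `P b = λ P a` (`a ≠ b`;
`λ = 0`: a point AT the origin; `λ = 1`: a repeated point), the rows `{a}, {a,b}, {b}` are dependent:
`row{a} = (1−λ)·row{a,b} + λ·row{b}`. -/
theorem det_segMatrix_eq_zero_of_collinear_origin {r : ℕ} (P : Fin h → Fin h → ℂ) (a b : Fin h) (lam : ℂ)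
    (hab : a ≠ b) (hP : ∀ x, P b x = lam * P a x)
    (uu : Fin r → Finset (Fin h)) (hsurj : ∀ S : Finset (Fin h), S.card ≤ 2 → ∃ i, uu i = S) :
    (segMatrix r P uu).det = 0 := by
  classical
  set M := segMatrix r P uu with hM
  obtain ⟨i₁, hi₁⟩ := hsurj {a} (by rw [Finset.card_singleton]; omega)
  obtain ⟨i₂, hi₂⟩ := hsurj {a, b} (by rw [Finset.card_pair hab])
  obtain ⟨i₃, hi₃⟩ := hsurj {b} (by rw [Finset.card_singleton]; omega)
  have n12 : i₁ ≠ i₂ := by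
    intro e
    have := congrArg Finset.card (show ({a} : Finset (Fin h)) = {a, b} by rw [← hi₁, ← hi₂, e])
    rw [Finset.card_singleton, Finset.card_pair hab] at this
    omega
  have n13 : i₁ ≠ i₃ := by
    intro e
    have := (show ({a} : Finset (Fin h)) = {b} by rw [← hi₁, ← hi₃, e])
    exact hab (Finset.singleton_injective this)
  have n32 : i₃ ≠ i₂ := by
    intro e
    have e' := hi₂
    rw [← e, hi₃] at e'
    have := congrArg Finset.card e'
    rw [Finset.card_singleton, Finset.card_pair hab] at this
    omega
  let v : Fin r → ℂ := Pi.single i₁ 1 - ((1 - lam) • Pi.single i₂ 1 + lam • Pi.single i₃ 1)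
  have hv0 : v ≠ 0 := by
    intro hv
    have := congr_fun hv i₁
    simp only [v, Pi.add_apply, Pi.sub_apply, Pi.smul_apply, Pi.single_eq_same, Pi.single_eq_of_ne n12,
      Pi.single_eq_of_ne n13, Pi.zero_apply, smul_eq_mul, mul_zero] at this
    norm_num at this
  have hvM : Matrix.vecMul v M = 0 := by
    funext j
    simp only [v, Matrix.add_vecMul, Matrix.sub_vecMul, Matrix.smul_vecMul, Matrix.single_one_vecMul, Pi.add_apply,
      Pi.sub_apply, Pi.smul_apply, Pi.zero_apply, smul_eq_mul]
    rw [hM, segMatrix_row_singleton P uu hi₁, segMatrix_row_singleton P uu hi₃, Matrix.row_apply,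
      segMatrix_row_pair P uu hab hi₂ j]
    exact pairSum_collinear_origin P hab hP (benchCols h r j)
  exact (Matrix.exists_vecMul_eq_zero_iff).mp ⟨v, hv0, hvM⟩

/-- **No three of `0, P_1, …, P_h` collinear — the line's form.**  A table with three affinely dependent points
(`P c = α P a + β P b`, `α + β = 1`, `a, b, c` distinct) is never a witness of `stub_segmentMeanValue` / `stub_s10` / `stub_zeroOneDesign`. -/
theorem det_eq_zero_of_collinear {r : ℕ} (P : Fin h → Fin h → ℂ) (a b c : Fin h) (α β : ℂ)
    (hab : a ≠ b) (hac : a ≠ c) (hbc : b ≠ c) (hαβ : α + β = 1) (hP : ∀ x, P c x = α * P a x + β * P b x)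
    (uu : Fin r → Finset (Fin h)) (hsurj : ∀ S : Finset (Fin h), S.card ≤ 2 → ∃ i, uu i = S) :
    (Matrix.of fun i j : Fin r =>
      ∑ g : (↥(benchCols h r j) → ↥(uu i)), (∏ c : ↥(benchCols h r j), P (g c) c) *
        ∏ a : ↥(uu i), ((Finset.univ.filter fun c : ↥(benchCols h r j) => g c = a).card.factorial : ℂ)).det = 0 :=
  det_segMatrix_eq_zero_of_collinear P a b c α β hab hac hbc hαβ hP uu hsurj

/-- **No point proportional to another — the line's form** (`P b = λ P a`, `a ≠ b`, any `λ`). -/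
theorem det_eq_zero_of_collinear_origin {r : ℕ} (P : Fin h → Fin h → ℂ) (a b : Fin h) (lam : ℂ)
    (hab : a ≠ b) (hP : ∀ x, P b x = lam * P a x)
    (uu : Fin r → Finset (Fin h)) (hsurj : ∀ S : Finset (Fin h), S.card ≤ 2 → ∃ i, uu i = S) :
    (Matrix.of fun i j : Fin r =>
      ∑ g : (↥(benchCols h r j) → ↥(uu i)), (∏ c : ↥(benchCols h r j), P (g c) c) *
        ∏ a : ↥(uu i), ((Finset.univ.filter fun c : ↥(benchCols h r j) => g c = a).card.factorial : ℂ)).det = 0 :=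
  det_segMatrix_eq_zero_of_collinear_origin P a b lam hab hP uu hsurj

end

end Summit.ValiantsHypothesis.ValiantsHypothesis.Theorems.BarrierLever.ChowBenchmarkHyperplane
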